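import Literature.Analysis.FluidPDE.BourgainPavlovicPieces
import HarnessLib

/-!
# Pair interactions of the Bourgain–Pavlović pieces and the second Picard iterate

Fifth support file for the discharge of the barrier
`Literature.Barriers.NavierStokesRegularity.CriticalBesovNormInflation` (Bourgain–Pavlović 2008,
Thm. 1.1). With the pieces `U_a` of the free evolution (`BourgainPavlovicPieces`), the second
Picard iterate `u₁ = duhamelBilin c U U` (Bourgain–Pavlović's `u₁`, their (3.5), `c = 4π²`) is
the sum over ordered pairs of bumps of the **pair interactions**
`P_{ab} = duhamelBilin c U_a U_b`; this file proves that expansion and the frequency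
bookkeeping of Bourgain–Pavlović's §3.2 (their split of `(e^{τΔ}u₀·∇)e^{τΔ}u₀` into the
resonant `N₁`, feeding the low mode `η`, and the off-diagonal `N₂`, `N₃`), in `L¹`-mass form:

* generic complements to the Fourier-side toolkit (namespace `FourierNS`): time-clamping
  `clampTime t = max t 0` (all objects are used for `t ≥ 0` only, and clamping makes decay bounds
  uniform in time), joint continuity and decay of `duhamelBilin c v w` for jointly continuous,
  uniformly decaying inputs, and its additivity over finite sums in each slot;
* the clamped free evolution `Uᶜ(t) = U(max t 0)` and its pieces, the **pair interaction**
  `pairTerm a b = duhamelBilin c Uᶜ_a Uᶜ_b`, and the **second iterate**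
  `secondIterate = duhamelBilin c Uᶜ Uᶜ = ∑_{a,b} pairTerm a b` (`secondIterate_eq_sum`);
* **supports**: `nonlin (U_a t) (U_b t) ξ = 0` and `pairTerm a b t ξ = 0` unless
  `‖ξ − (c_a + c_b)‖ < 2ρ`; the free evolution vanishes on `‖ξ‖ ≤ 6`;
* **classification of the sums of centres**: for a *low pair* (same scale, opposite signs)
  `c_a + c_b ∈ {0, ±η}` (`‖c_a + c_b‖ ≤ 1`); for every other (*high*) pair
  `(7/8) max(N_a,N_b) ≤ ‖c_a + c_b‖ ≤ N_a + N_b + 2` (lacunarity `N_{s+1} ≥ 8 N_s`);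
* **masses of the pair interactions**: a low pair has `massL1 (pairTerm a b t) ≤ 6 α² m²` for all
  `t ≥ 0`, a high pair has `massL1 (pairTerm a b t) ≤ 45 α² m² min(N_a,N_b) e^{-π² max(N_a,N_b)² t}`
  (Bourgain–Pavlović's estimates for `N₂`, `N₃` and the low mode, (3.7)–(3.12), in `L¹` form:
  the off-diagonal outputs live at frequency `≥ (3/4) N_max`, where the heat flow damps them, and
  carry the lacunary factor `N_min/N_max`).

## References

* J. Bourgain, N. Pavlović, J. Funct. Anal. 255 (2008), §3.2, (3.5)–(3.12). [BourgainPavlovic2008]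
-/

noncomputable section

open MeasureTheory Real Set Filter Topology Function Complex intervalIntegral
open scoped ComplexConjugate ENNReal NNReal

/-! ### Generic complements -/

namespace Literature.Analysis.FluidPDE.FourierNS

variable {ι : Type*} [Fintype ι] [DecidableEq ι]

/-- **Joint continuity of the Duhamel bilinear term** for jointly continuous inputs with decay of
the integrable order `K₀` uniform in time. [folklore] -/
theorem continuous_duhamelBilin {K₀ : ℕ} (hK₀ : Fintype.card ι < K₀) (c : ℝ)
    {v w : ℝ → EuclideanSpace ℝ ι → ι → ℂ} {A B : ℝ}
    (hvc : Continuous (uncurry v)) (hwc : Continuous (uncurry w))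
    (hv : ∀ t, HasDecay K₀ A (v t)) (hw : ∀ t, HasDecay K₀ B (w t)) :
    Continuous (uncurry (duhamelBilin c v w)) := by
  -- the integrand `((t, ξ), r) ↦ e^{-c‖ξ‖²(t-r)} N(v r, w r)(ξ)` is jointly continuous
  have hN : Continuous fun q : (ℝ × EuclideanSpace ℝ ι) × ℝ => nonlin (v q.2) (w q.2) q.1.2 :=
    continuous_nonlin_param (X := (ℝ × EuclideanSpace ℝ ι) × ℝ) hK₀
      (V := fun q => v q.2) (W := fun q => w q.2) (ζ := fun q => q.1.2)
      (fun q => (hvc.uncurry_left q.2).aestronglyMeasurable)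
      (fun q => (hwc.uncurry_left q.2).aestronglyMeasurable) (fun q => hv q.2) (fun q => hw q.2)
      (fun η => hvc.comp (continuous_snd.prodMk continuous_const))
      (fun η => hwc.comp (continuous_snd.prodMk ((continuous_snd.comp continuous_fst).sub
        continuous_const)))
      (continuous_snd.comp continuous_fst)
  have hF : Continuous (uncurry fun (p : ℝ × EuclideanSpace ℝ ι) (r : ℝ) =>
      heat c p.2 (p.1 - r) • nonlin (v r) (w r) p.2) := by
    change Continuous fun q : (ℝ × EuclideanSpace ℝ ι) × ℝ =>
      heat c q.1.2 (q.1.1 - q.2) • nonlin (v q.2) (w q.2) q.1.2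
    exact (continuous_heat_comp c (continuous_snd.comp continuous_fst)
      ((continuous_fst.comp continuous_fst).sub continuous_snd)).smul hN
  exact intervalIntegral.continuous_parametric_intervalIntegral_of_continuous (μ := volume)
    (a₀ := 0) hF continuous_fst

/-- **Decay of the Duhamel bilinear term** on `[0, T]`: order `K` from inputs of orders `K₀` and
`K + 1`, uniform in time, with constant `T · C(ι,K+1,K₀)(A B₀ + A₀ B)` (`c ≥ 0`). [folklore] -/
theorem hasDecay_duhamelBilin {K₀ K : ℕ} (hK₀ : Fintype.card ι < K₀) {c : ℝ} (hc : 0 ≤ c)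
    {v w : ℝ → EuclideanSpace ℝ ι → ι → ℂ} {A₀ A B₀ B T : ℝ}
    (hvc : Continuous (uncurry v)) (hwc : Continuous (uncurry w))
    (hv₀ : ∀ t, HasDecay K₀ A₀ (v t)) (hv : ∀ t, HasDecay (K + 1) A (v t))
    (hw₀ : ∀ t, HasDecay K₀ B₀ (w t)) (hw : ∀ t, HasDecay (K + 1) B (w t))
    {t : ℝ} (ht : t ∈ Icc 0 T) :
    HasDecay K (T * (nonlinConst ι (K + 1) K₀ * (A * B₀ + A₀ * B))) (duhamelBilin c v w t) := by
  intro ξ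
  set M : ℝ := nonlinConst ι (K + 1) K₀ * (A * B₀ + A₀ * B) with hM
  have hdecay : ∀ r, HasDecay K M (nonlin (v r) (w r)) := fun r =>
    hasDecay_nonlin hK₀ (hv₀ r) (hv r) (hw₀ r) (hw r) (hvc.uncurry_left r).aestronglyMeasurable
      (hwc.uncurry_left r).aestronglyMeasurable
  have hM0 : 0 ≤ M := (hdecay 0).nonneg
  have hdec : ∀ r, ‖nonlin (v r) (w r) ξ‖ ≤ M * ((1 + ‖ξ‖) ^ K)⁻¹ := fun r => hdecay r ξ
  rw [duhamelBilin_apply]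
  calc ‖∫ r in (0 : ℝ)..t, heat c ξ (t - r) • nonlin (v r) (w r) ξ‖
      ≤ (M * ((1 + ‖ξ‖) ^ K)⁻¹) * |t - 0| := by
        refine intervalIntegral.norm_integral_le_of_norm_le_const fun r hr => ?_
        rw [uIoc_of_le ht.1] at hr
        rw [norm_smul, Real.norm_of_nonneg (heat_nonneg _ _ _)]
        calc heat c ξ (t - r) * ‖nonlin (v r) (w r) ξ‖ ≤ 1 * (M * ((1 + ‖ξ‖) ^ K)⁻¹) :=
              mul_le_mul (heat_le_one hc (by linarith [hr.2]) ξ) (hdec r) (norm_nonneg _) zero_le_one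
          _ = M * ((1 + ‖ξ‖) ^ K)⁻¹ := one_mul _
    _ ≤ T * M * ((1 + ‖ξ‖) ^ K)⁻¹ := by
        rw [sub_zero, abs_of_nonneg ht.1]
        have : 0 ≤ M * ((1 + ‖ξ‖) ^ K)⁻¹ := by positivity
        nlinarith [ht.2]
    _ = _ := by rw [hM]

/-- **Additivity of the Duhamel term over finite sums in the first slot** (bilinearity of
`nonlin` and linearity of the time integral; inputs jointly continuous with uniform decay). [folklore] -/
theorem duhamelBilin_finset_sum_left {α : Type*} (S : Finset α) {K₀ : ℕ}
    (hK₀ : Fintype.card ι < K₀) (c : ℝ) {v : α → ℝ → EuclideanSpace ℝ ι → ι → ℂ}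
    {w : ℝ → EuclideanSpace ℝ ι → ι → ℂ} {A : α → ℝ} {B : ℝ}
    (hvc : ∀ a ∈ S, Continuous (uncurry (v a))) (hwc : Continuous (uncurry w))
    (hv : ∀ a ∈ S, ∀ t, HasDecay K₀ (A a) (v a t)) (hw : ∀ t, HasDecay K₀ B (w t)) (t : ℝ)
    (ξ : EuclideanSpace ℝ ι) :
    duhamelBilin c (fun r η => ∑ a ∈ S, v a r η) w t ξ = ∑ a ∈ S, duhamelBilin c (v a) w t ξ := by
  simp only [duhamelBilin_apply]
  have hpt : ∀ r, nonlin (fun η => ∑ a ∈ S, v a r η) (w r) ξ = ∑ a ∈ S, nonlin (v a r) (w r) ξ :=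
    fun r => nonlin_finset_sum_left S hK₀ (fun a ha => hv a ha r)
      (fun a ha => ((hvc a ha).uncurry_left r).aestronglyMeasurable) (hw r)
      (hwc.uncurry_left r).aestronglyMeasurable ξ
  simp_rw [hpt, Finset.smul_sum]
  rw [intervalIntegral.integral_finsetSum]
  intro a ha
  refine (Continuous.intervalIntegrable ?_ _ _)
  have hN : Continuous fun r => nonlin (v a r) (w r) ξ :=
    continuous_nonlin_param (X := ℝ) hK₀ (V := fun r => v a r) (W := fun r => w r) (ζ := fun _ => ξ)
      (fun r => ((hvc a ha).uncurry_left r).aestronglyMeasurable)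
      (fun r => (hwc.uncurry_left r).aestronglyMeasurable) (fun r => hv a ha r) (fun r => hw r)
      (fun η => (hvc a ha).comp (continuous_id.prodMk continuous_const))
      (fun η => hwc.comp (continuous_id.prodMk continuous_const)) continuous_const
  exact (continuous_heat_comp c continuous_const (continuous_const.sub continuous_id)).smul hN

/-- **Additivity of the Duhamel term over finite sums in the second slot.** [folklore] -/
theorem duhamelBilin_finset_sum_right {α : Type*} (S : Finset α) {K₀ : ℕ}
    (hK₀ : Fintype.card ι < K₀) (c : ℝ) {v : ℝ → EuclideanSpace ℝ ι → ι → ℂ}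
    {w : α → ℝ → EuclideanSpace ℝ ι → ι → ℂ} {A : ℝ} {B : α → ℝ}
    (hvc : Continuous (uncurry v)) (hwc : ∀ a ∈ S, Continuous (uncurry (w a)))
    (hv : ∀ t, HasDecay K₀ A (v t)) (hw : ∀ a ∈ S, ∀ t, HasDecay K₀ (B a) (w a t)) (t : ℝ)
    (ξ : EuclideanSpace ℝ ι) :
    duhamelBilin c v (fun r η => ∑ a ∈ S, w a r η) t ξ = ∑ a ∈ S, duhamelBilin c v (w a) t ξ := by
  simp only [duhamelBilin_apply]
  have hpt : ∀ r, nonlin (v r) (fun η => ∑ a ∈ S, w a r η) ξ = ∑ a ∈ S, nonlin (v r) (w a r) ξ :=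
    fun r => nonlin_finset_sum_right S hK₀ (hv r) (hvc.uncurry_left r).aestronglyMeasurable
      (fun a ha => hw a ha r) (fun a ha => ((hwc a ha).uncurry_left r).aestronglyMeasurable) ξ
  simp_rw [hpt, Finset.smul_sum]
  rw [intervalIntegral.integral_finsetSum]
  intro a ha
  refine (Continuous.intervalIntegrable ?_ _ _)
  have hN : Continuous fun r => nonlin (v r) (w a r) ξ :=
    continuous_nonlin_param (X := ℝ) hK₀ (V := fun r => v r) (W := fun r => w a r) (ζ := fun _ => ξ)
      (fun r => (hvc.uncurry_left r).aestronglyMeasurable)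
      (fun r => ((hwc a ha).uncurry_left r).aestronglyMeasurable) (fun r => hv r) (fun r => hw a ha r)
      (fun η => hvc.comp (continuous_id.prodMk continuous_const))
      (fun η => (hwc a ha).comp (continuous_id.prodMk continuous_const)) continuous_const
  exact (continuous_heat_comp c continuous_const (continuous_const.sub continuous_id)).smul hN

end Literature.Analysis.FluidPDE.FourierNS

/-! ### The pair interactions -/

namespace Literature.Analysis.FluidPDE.BourgainPavlovic

open FourierNS Literature.Analysis.FunctionSpaces

/-- Local notation for frequency space `ℝ³`. -/
local notation "E3" => EuclideanSpace ℝ (Fin 3)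

namespace InflationParams

variable (d : InflationParams)

/-! #### The clamped free evolution and its pieces -/

/-- **The time-clamped free evolution** `Uᶜ(t) = U(max t 0)`: equal to `U` for `t ≥ 0`, constant
(`= a₀`) for `t ≤ 0`, so that its decay bounds are uniform in `t ∈ ℝ` (the Duhamel terms only
integrate over `[0, t]`). [folklore] -/
def freeC (t : ℝ) : E3 → Fin 3 → ℂ := d.free (max t 0)

/-- The clamped pieces `Uᶜ_a(t) = U_a(max t 0)`. [folklore] -/
def freePieceC (a : ℕ × Bool × Bool) (t : ℝ) : E3 → Fin 3 → ℂ := d.freePiece a (max t 0)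

/-- For `t ≥ 0` the clamped free evolution is the free evolution. [folklore] -/
theorem freeC_of_nonneg {t : ℝ} (ht : 0 ≤ t) : d.freeC t = d.free t := by
  rw [freeC, max_eq_left ht]

/-- For `t ≥ 0` the clamped pieces are the pieces. [folklore] -/
theorem freePieceC_of_nonneg (a : ℕ × Bool × Bool) {t : ℝ} (ht : 0 ≤ t) :
    d.freePieceC a t = d.freePiece a t := by
  rw [freePieceC, max_eq_left ht]

/-- `Uᶜ(0) = a₀`. [folklore] -/
@[simp]
theorem freeC_zero : d.freeC 0 = d.datum := by
  rw [d.freeC_of_nonneg le_rfl, free_zero]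

/-- The clamped free evolution is the sum of the clamped pieces. [folklore] -/
theorem freeC_eq_sum_fun (t : ℝ) : d.freeC t = fun η => ∑ a ∈ d.idx, d.freePieceC a t η :=
  d.free_eq_sum_fun (max t 0)

/-- The clamped free evolution is jointly continuous. [folklore] -/
theorem continuous_freeC : Continuous (uncurry d.freeC) := by
  change Continuous ((uncurry d.free) ∘ fun p : ℝ × E3 => (max p.1 0, p.2))
  exact d.continuous_free.comp ((continuous_fst.max continuous_const).prodMk continuous_snd)

/-- The clamped pieces are jointly continuous. [folklore] -/
theorem continuous_freePieceC (a : ℕ × Bool × Bool) : Continuous (uncurry (d.freePieceC a)) := by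
  change Continuous ((uncurry (d.freePiece a)) ∘ fun p : ℝ × E3 => (max p.1 0, p.2))
  exact (d.continuous_freePiece a).comp ((continuous_fst.max continuous_const).prodMk continuous_snd)

/-- **Uniform decay of the clamped pieces**, of every order. [folklore] -/
theorem hasDecay_freePieceC (a : ℕ × Bool × Bool) (t : ℝ) (K : ℕ) :
    HasDecay K (d.α * (d.N a.1 + 2) * (d.N a.1 + 3) ^ K) (d.freePieceC a t) :=
  d.hasDecay_freePiece a (le_max_right t 0) K

/-- **Uniform decay of the clamped free evolution**, of every order (heat factor `≤ 1`). [folklore] -/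
theorem hasDecay_freeC (t : ℝ) (K : ℕ) :
    HasDecay K (4 * d.α * d.r * d.suppRadius * (1 + d.suppRadius) ^ K) (d.freeC t) := by
  intro ξ
  calc ‖d.freeC t ξ‖ = ‖d.free (max t 0) ξ‖ := rfl
    _ ≤ ‖d.datum ξ‖ := d.norm_free_le (le_max_right t 0) ξ
    _ ≤ _ := d.hasDecay_datum K ξ

/-- Pointwise size of the clamped pieces: `‖Uᶜ_a(t,η)‖ ≤ α ψ(η − c_a)(N_s + 2) e^{-2π² N_s² max(t,0)}`. [folklore] -/
theorem norm_freePieceC_le (a : ℕ × Bool × Bool) (t : ℝ) (η : E3) :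
    ‖d.freePieceC a t η‖ ≤ d.α * d.ψ (η - d.center a) * (d.N a.1 + 2) *
      Real.exp (-(2 * π ^ 2 * d.N a.1 ^ 2) * max t 0) :=
  d.norm_freePiece_le a (le_max_right t 0) η

/-- Support of the clamped pieces. [folklore] -/
theorem norm_sub_center_lt_of_freePieceC_ne_zero {a : ℕ × Bool × Bool} {t : ℝ} {η : E3}
    (h : d.freePieceC a t η ≠ 0) : ‖η - d.center a‖ < d.ρ :=
  d.norm_sub_center_lt_of_freePiece_ne_zero h

/-- Mass of the clamped pieces: `massL1 (Uᶜ_a t) ≤ α (N_s + 2) m e^{-2π² N_s² max(t,0)}`. [folklore] -/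
theorem massL1_freePieceC_le (a : ℕ × Bool × Bool) (t : ℝ) :
    massL1 (d.freePieceC a t) ≤ ENNReal.ofReal
      (d.α * (d.N a.1 + 2) * d.bumpMass * Real.exp (-(2 * π ^ 2 * d.N a.1 ^ 2) * max t 0)) :=
  d.massL1_freePiece_le a (le_max_right t 0)

/-- **The free evolution vanishes at low frequency**: `U(t, ξ) = 0` for `‖ξ‖ ≤ 6` (every piece
lives on `‖ξ‖ > N_s − 2 ≥ 6`). [folklore] -/
theorem free_eq_zero_of_norm_le_six (t : ℝ) {ξ : E3} (h : ‖ξ‖ ≤ 6) : d.free t ξ = 0 := by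
  have hd : d.datum ξ = 0 := by
    ext l
    rw [datum_apply]
    have hz : ∀ s ∈ Finset.range d.r, (d.piece s ξ l : ℂ) = 0 := fun s _ => by
      rw [d.piece_eq_zero (Or.inl (by linarith [d.eight_le_N s])) l, Complex.ofReal_zero]
    rw [Finset.sum_eq_zero hz, mul_zero]
    rfl
  rw [free_apply, hd, smul_zero]

/-- The clamped free evolution vanishes on `‖ξ‖ ≤ 6`. [folklore] -/
theorem freeC_eq_zero_of_norm_le_six (t : ℝ) {ξ : E3} (h : ‖ξ‖ ≤ 6) : d.freeC t ξ = 0 :=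
  d.free_eq_zero_of_norm_le_six _ h

/-! #### Supports of the pair interactions -/

/-- **Two pieces only interact near the sum of their centres**: if
`2ρ ≤ ‖ξ − (c_a + c_b)‖` then `U_a(t,η)_j · U_b(t,ξ-η)_k = 0` for every `η`. [cite: BourgainPavlovic2008, §3.2 (supports of `N₁`, `N₂`, `N₃`)] -/
theorem freePieceC_mul_freePieceC_eq_zero {a b : ℕ × Bool × Bool} (t t' : ℝ) {ξ : E3}
    (hξ : 2 * d.ρ ≤ ‖ξ - (d.center a + d.center b)‖) (η : E3) (j k : Fin 3) :
    d.freePieceC a t η j * d.freePieceC b t' (ξ - η) k = 0 := by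
  by_cases ha : d.freePieceC a t η = 0
  · rw [show d.freePieceC a t η j = 0 from congrFun ha j, zero_mul]
  by_cases hb : d.freePieceC b t' (ξ - η) = 0
  · rw [show d.freePieceC b t' (ξ - η) k = 0 from congrFun hb k, mul_zero]
  exfalso
  have h1 := d.norm_sub_center_lt_of_freePieceC_ne_zero ha
  have h2 := d.norm_sub_center_lt_of_freePieceC_ne_zero hb
  have : ‖ξ - (d.center a + d.center b)‖ < 2 * d.ρ := by
    calc ‖ξ - (d.center a + d.center b)‖ = ‖(η - d.center a) + (ξ - η - d.center b)‖ := by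
          congr 1; abel
      _ ≤ ‖η - d.center a‖ + ‖ξ - η - d.center b‖ := norm_add_le _ _
      _ < d.ρ + d.ρ := add_lt_add h1 h2
      _ = 2 * d.ρ := by ring
  linarith

/-- The modulus convolution of two pieces vanishes off the ball of radius `2ρ` about the sum of
the centres (hypothesis `hS` of `massL1_duhamelBilin_le_of_support`). [folklore] -/
theorem lintegral_freePieceC_mul_eq_zero {a b : ℕ × Bool × Bool} (t t' : ℝ) {ξ : E3}
    (hξ : 2 * d.ρ ≤ ‖ξ - (d.center a + d.center b)‖) :
    ∫⁻ η, ‖d.freePieceC a t η‖ₑ * ‖d.freePieceC b t' (ξ - η)‖ₑ = 0 := by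
  refine (lintegral_eq_zero_iff' ?_).2 (Eventually.of_forall fun η => ?_)
  · exact ((d.continuous_freePieceC a).uncurry_left t).enorm.aemeasurable.mul
      (((d.continuous_freePieceC b).uncurry_left t').comp (continuous_const.sub continuous_id)
        |>.enorm.aemeasurable)
  · simp only [Pi.zero_apply, mul_eq_zero, enorm_eq_zero]
    by_contra hc
    push Not at hc
    have h1 := d.norm_sub_center_lt_of_freePieceC_ne_zero hc.1
    have h2 := d.norm_sub_center_lt_of_freePieceC_ne_zero hc.2
    have : ‖ξ - (d.center a + d.center b)‖ < 2 * d.ρ := by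
      calc ‖ξ - (d.center a + d.center b)‖ = ‖(η - d.center a) + (ξ - η - d.center b)‖ := by
            congr 1; abel
        _ ≤ ‖η - d.center a‖ + ‖ξ - η - d.center b‖ := norm_add_le _ _
        _ < d.ρ + d.ρ := add_lt_add h1 h2
        _ = 2 * d.ρ := by ring
    linarith

/-- **The pair nonlinearity is supported near the sum of the centres**:
`nonlin (Uᶜ_a t) (Uᶜ_b t') ξ = 0` if `2ρ ≤ ‖ξ − (c_a + c_b)‖`. [cite: BourgainPavlovic2008, §3.2] -/
theorem nonlin_freePieceC_eq_zero {a b : ℕ × Bool × Bool} (t t' : ℝ) {ξ : E3}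
    (hξ : 2 * d.ρ ≤ ‖ξ - (d.center a + d.center b)‖) :
    nonlin (d.freePieceC a t) (d.freePieceC b t') ξ = 0 := by
  ext l
  rw [nonlin_apply]
  have hz : ∀ j k, fconv (fun η => d.freePieceC a t η j) (fun η => d.freePieceC b t' η k) ξ = 0 :=
    fun j k => by
      rw [fconv_apply]
      simp_rw [d.freePieceC_mul_freePieceC_eq_zero t t' hξ]
      exact integral_zero _ _
  simp [hz]

/-! #### The pair interactions and the second iterate -/

/-- **The pair interaction** of the bumps `a`, `b`:
`P_{ab} = duhamelBilin (4π²) Uᶜ_a Uᶜ_b`. [cite: BourgainPavlovic2008, (3.5) (the pieces of `u₁`)] -/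
def pairTerm (a b : ℕ × Bool × Bool) : ℝ → E3 → Fin 3 → ℂ :=
  duhamelBilin (4 * π ^ 2) (d.freePieceC a) (d.freePieceC b)

/-- **The second Picard iterate** `u₁ = duhamelBilin (4π²) Uᶜ Uᶜ` (Bourgain–Pavlović's
`u₁ = 𝓑(e^{tΔ}u₀, e^{tΔ}u₀)`, (3.5), on the Fourier side with clamped time). [cite: BourgainPavlovic2008, (3.5)] -/
def secondIterate : ℝ → E3 → Fin 3 → ℂ := duhamelBilin (4 * π ^ 2) d.freeC d.freeC

/-- **The second iterate is the sum of the pair interactions.** [cite: BourgainPavlovic2008, §3.2 (expansion of `u₁`)] -/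
theorem secondIterate_eq_sum (t : ℝ) (ξ : E3) :
    d.secondIterate t ξ = ∑ a ∈ d.idx, ∑ b ∈ d.idx, d.pairTerm a b t ξ := by
  have h4 := card_fin_three_lt_four
  rw [secondIterate, show d.freeC = fun r η => ∑ a ∈ d.idx, d.freePieceC a r η from
    funext d.freeC_eq_sum_fun]
  rw [duhamelBilin_finset_sum_left d.idx h4 (4 * π ^ 2) (A := fun a => d.α * (d.N a.1 + 2) * (d.N a.1 + 3) ^ 4)
    (B := ∑ a ∈ d.idx, d.α * (d.N a.1 + 2) * (d.N a.1 + 3) ^ 4)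
    (fun a _ => d.continuous_freePieceC a) ?_ (fun a _ t => d.hasDecay_freePieceC a t 4)
    (fun t => hasDecay_finset_sum d.idx fun a _ => d.hasDecay_freePieceC a t 4)]
  · refine Finset.sum_congr rfl fun a _ => ?_
    rw [duhamelBilin_finset_sum_right d.idx h4 (4 * π ^ 2)
      (B := fun b => d.α * (d.N b.1 + 2) * (d.N b.1 + 3) ^ 4) (d.continuous_freePieceC a)
      (fun b _ => d.continuous_freePieceC b) (fun t => d.hasDecay_freePieceC a t 4)
      (fun b _ t => d.hasDecay_freePieceC b t 4)]
    rfl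
  · change Continuous fun p : ℝ × E3 => ∑ a ∈ d.idx, d.freePieceC a p.1 p.2
    exact continuous_finsetSum _ fun a _ => d.continuous_freePieceC a

/-- **The pair interactions are supported near the sum of the centres**:
`pairTerm a b t ξ = 0` if `2ρ ≤ ‖ξ − (c_a + c_b)‖`. [cite: BourgainPavlovic2008, §3.2] -/
theorem pairTerm_eq_zero {a b : ℕ × Bool × Bool} (t : ℝ) {ξ : E3}
    (hξ : 2 * d.ρ ≤ ‖ξ - (d.center a + d.center b)‖) : d.pairTerm a b t ξ = 0 := by
  rw [pairTerm, duhamelBilin_apply]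
  simp [d.nonlin_freePieceC_eq_zero _ _ hξ]

/-- The pair interactions are jointly continuous. [folklore] -/
theorem continuous_pairTerm (a b : ℕ × Bool × Bool) : Continuous (uncurry (d.pairTerm a b)) :=
  continuous_duhamelBilin card_fin_three_lt_four _ (d.continuous_freePieceC a)
    (d.continuous_freePieceC b) (fun t => d.hasDecay_freePieceC a t 4)
    (fun t => d.hasDecay_freePieceC b t 4)

/-- The second iterate is jointly continuous. [folklore] -/
theorem continuous_secondIterate : Continuous (uncurry d.secondIterate) :=
  continuous_duhamelBilin card_fin_three_lt_four _ d.continuous_freeC d.continuous_freeC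
    (fun t => d.hasDecay_freeC t 4) (fun t => d.hasDecay_freeC t 4)

/-- **Decay of the second iterate** of every order on `[0, T]`, uniform in time. [folklore] -/
theorem hasDecay_secondIterate (K : ℕ) (T : ℝ) : ∃ B : ℝ, ∀ t ∈ Icc 0 T,
    HasDecay K B (d.secondIterate t) :=
  ⟨_, fun t ht => hasDecay_duhamelBilin card_fin_three_lt_four (by positivity)
    d.continuous_freeC d.continuous_freeC (fun t => d.hasDecay_freeC t 4)
    (fun t => d.hasDecay_freeC t (K + 1)) (fun t => d.hasDecay_freeC t 4)
    (fun t => d.hasDecay_freeC t (K + 1)) ht⟩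

/-! #### Classification of the sums of centres -/

/-- A **low pair**: same scale, opposite signs (the resonant pairs of Bourgain–Pavlović's `N₁`,
together with the pairs `(k_s, -k_s)`, `(k'_s, -k'_s)` whose sum of centres is `0`). [cite: BourgainPavlovic2008, §3.2 (`N₁`)] -/
def _root_.Literature.Analysis.FluidPDE.BourgainPavlovic.IsLowPair (a b : ℕ × Bool × Bool) : Prop :=
  a.1 = b.1 ∧ a.2.1 ≠ b.2.1

/-- Being a low pair is decidable (used to split finite sums over pairs). [folklore] -/
instance _root_.Literature.Analysis.FluidPDE.BourgainPavlovic.instDecidableIsLowPair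
    (a b : ℕ × Bool × Bool) : Decidable (IsLowPair a b) := by
  unfold IsLowPair; infer_instance

/-- **Sum of centres of a low pair**: `c_a + c_b = sgn_a ([τ_b] − [τ_a]) η`. [folklore] -/
theorem center_add_center_of_low {a b : ℕ × Bool × Bool} (h : IsLowPair a b) :
    d.center a + d.center b =
      (sgn a.2.1 * ((if b.2.2 then 1 else 0) - (if a.2.2 then 1 else 0))) • η := by
  rcases a with ⟨s, σ, τ⟩
  rcases b with ⟨s', σ', τ'⟩
  obtain ⟨hs, hσ⟩ := h
  simp only at hs hσ
  subst hs
  have hσ' : σ' = !σ := by cases σ <;> cases σ' <;> simp_all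
  subst hσ'
  cases σ <;> cases τ <;> cases τ' <;> simp [center, sgn, smul_sub] <;> abel

/-- For a low pair `‖c_a + c_b‖ ≤ 1`. [folklore] -/
theorem norm_center_add_center_le_one_of_low {a b : ℕ × Bool × Bool} (h : IsLowPair a b) :
    ‖d.center a + d.center b‖ ≤ 1 := by
  rw [d.center_add_center_of_low h, norm_smul, norm_η, mul_one, Real.norm_eq_abs, abs_mul, abs_sgn,
    one_mul]
  rcases a with ⟨s, σ, τ⟩; rcases b with ⟨s', σ', τ'⟩
  cases τ <;> cases τ' <;> simp

/-- Lacunarity across scales: `s < s' → 8 N_s ≤ N_{s'}`. [cite: BourgainPavlovic2008, §3.1 ("very lacunary")] -/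
theorem eight_mul_N_le_of_lt {s s' : ℕ} (h : s < s') : 8 * d.N s ≤ d.N s' := by
  have key : ∀ k : ℕ, 8 * d.N s ≤ d.N (s + 1 + k) := by
    intro k
    induction k with
    | zero => simpa using d.eight_mul_N_le s
    | succ k ih => exact ih.trans (by simpa [Nat.add_assoc] using d.N_le_N_succ (s + 1 + k))
  obtain ⟨k, rfl⟩ : ∃ k, s' = s + 1 + k := ⟨s' - (s + 1), by omega⟩
  exact key k

/-- The `e₁`-coordinate of a centre: `(c_a)_1 = sgn_a N_s`. [folklore] -/
theorem center_apply_one (a : ℕ × Bool × Bool) : d.center a 1 = sgn a.2.1 * d.N a.1 := by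
  rw [center_apply]
  simp

/-- **Sum of centres of a high pair**: `(7/8) max(N_a, N_b) ≤ ‖c_a + c_b‖` (distinct scales are
lacunary; equal scales with equal signs double). [cite: BourgainPavlovic2008, §3.2 (`N₂`, `N₃`)] -/
theorem norm_center_add_center_ge_of_not_low {a b : ℕ × Bool × Bool} (h : ¬IsLowPair a b) :
    (7 / 8) * max (d.N a.1) (d.N b.1) ≤ ‖d.center a + d.center b‖ := by
  have hcoord : |(d.center a + d.center b) 1| ≤ ‖d.center a + d.center b‖ := abs_apply_le_norm _ 1
  have h1 : (d.center a + d.center b) 1 = sgn a.2.1 * d.N a.1 + sgn b.2.1 * d.N b.1 := by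
    rw [PiLp.add_apply, center_apply_one, center_apply_one]
  rw [h1] at hcoord
  refine le_trans ?_ hcoord
  have hNa := d.N_pos a.1; have hNb := d.N_pos b.1
  set x : ℝ := sgn a.2.1 * d.N a.1 with hx
  set y : ℝ := sgn b.2.1 * d.N b.1 with hy
  have hax : |x| = d.N a.1 := by rw [hx, abs_mul, abs_sgn, one_mul, abs_of_pos hNa]
  have hay : |y| = d.N b.1 := by rw [hy, abs_mul, abs_sgn, one_mul, abs_of_pos hNb]
  -- `|y| - |x| ≤ |x + y|` and `|x| - |y| ≤ |x + y|`
  have t1 : |y| - |x| ≤ |x + y| := by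
    have := abs_add_le (x + y) (-x)
    rw [abs_neg, show x + y + -x = y by ring] at this
    linarith
  have t2 : |x| - |y| ≤ |x + y| := by
    have := abs_add_le (x + y) (-y)
    rw [abs_neg, show x + y + -y = x by ring] at this
    linarith
  rw [hax, hay] at t1 t2
  rcases Nat.lt_trichotomy a.1 b.1 with hlt | heq | hgt
  · have h8 := d.eight_mul_N_le_of_lt hlt
    rw [max_eq_right (by linarith)]
    linarith
  · -- same scale: not low forces equal signs, and `x + y = 2x`
    have hσ : a.2.1 = b.2.1 := by
      by_contra hne
      exact h ⟨heq, hne⟩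
    have hxy : y = x := by rw [hx, hy, hσ, heq]
    rw [hxy, ← heq, max_self, show x + x = 2 * x by ring, abs_mul, abs_of_pos (by norm_num : (0:ℝ) < 2),
      hax]
    linarith
  · have h8 := d.eight_mul_N_le_of_lt hgt
    rw [max_eq_left (by linarith)]
    linarith

/-- `‖c_a + c_b‖ ≤ N_a + N_b + 2`. [folklore] -/
theorem norm_center_add_center_le (a b : ℕ × Bool × Bool) :
    ‖d.center a + d.center b‖ ≤ d.N a.1 + d.N b.1 + 2 := by
  have := d.norm_center_le a; have := d.norm_center_le b
  linarith [norm_add_le (d.center a) (d.center b)]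

/-- **Frequencies in the output ball of a high pair are large**: for `‖ξ − (c_a + c_b)‖ < 2ρ`,
`(3/4) max(N_a,N_b) ≤ ‖ξ‖ ≤ N_a + N_b + 3`. [folklore] -/
theorem norm_bounds_of_mem_outputBall_of_not_low {a b : ℕ × Bool × Bool} (h : ¬IsLowPair a b)
    {ξ : E3} (hξ : ‖ξ - (d.center a + d.center b)‖ < 2 * d.ρ) :
    (3 / 4) * max (d.N a.1) (d.N b.1) ≤ ‖ξ‖ ∧ ‖ξ‖ ≤ d.N a.1 + d.N b.1 + 3 := by
  have hρ := d.ρ_le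
  have hlo := d.norm_center_add_center_ge_of_not_low h
  have hhi := d.norm_center_add_center_le a b
  have h1 : ‖d.center a + d.center b‖ - ‖ξ‖ ≤ ‖ξ - (d.center a + d.center b)‖ := by
    rw [norm_sub_rev]; exact norm_sub_norm_le _ _
  have h2 : ‖ξ‖ - ‖d.center a + d.center b‖ ≤ ‖ξ - (d.center a + d.center b)‖ := norm_sub_norm_le _ _
  have hmax8 : 8 ≤ max (d.N a.1) (d.N b.1) := le_max_of_le_left (d.eight_le_N a.1)
  have hNa : d.N a.1 ≤ max (d.N a.1) (d.N b.1) := le_max_left _ _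
  have hNb : d.N b.1 ≤ max (d.N a.1) (d.N b.1) := le_max_right _ _
  constructor <;> linarith

/-- Frequencies in the output ball of a low pair are small: `‖ξ‖ ≤ 6/5`. [folklore] -/
theorem norm_le_of_mem_outputBall_of_low {a b : ℕ × Bool × Bool} (h : IsLowPair a b)
    {ξ : E3} (hξ : ‖ξ - (d.center a + d.center b)‖ < 2 * d.ρ) : ‖ξ‖ ≤ 6 / 5 := by
  have hρ := d.ρ_le
  have hlo := d.norm_center_add_center_le_one_of_low h
  have h2 : ‖ξ‖ - ‖d.center a + d.center b‖ ≤ ‖ξ - (d.center a + d.center b)‖ := norm_sub_norm_le _ _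
  linarith

/-! #### Masses of the pair interactions -/

/-- The constant of the nonlinear mass estimate on `ℝ³`: `nonlinMassConst (Fin 3) = 36π`. [folklore] -/
theorem nonlinMassConst_fin_three : nonlinMassConst (Fin 3) = ENNReal.ofReal (36 * π) := by
  rw [nonlinMassConst, Fintype.card_fin]
  congr 1
  push_cast
  ring

/-- **Mass of a low pair interaction**: for a low pair and `t ≥ 0`,
`massL1 (pairTerm a b t) ≤ 6 α² m²` (the low-mode size `Q²/r` per pair, `α = Q/√r`, uniformly
in time; Bourgain–Pavlović's `∼ Q²` bound (3.7) for `N₁` after summing the `r` scales). [cite: BourgainPavlovic2008, (3.7)] -/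
theorem massL1_pairTerm_le_of_low {a b : ℕ × Bool × Bool} (h : IsLowPair a b) {t : ℝ}
    (ht : 0 ≤ t) :
    massL1 (d.pairTerm a b t) ≤ ENNReal.ofReal (6 * d.α ^ 2 * d.bumpMass ^ 2) := by
  have hα := d.α_pos.le
  have hm := d.bumpMass_nonneg
  have hs : a.1 = b.1 := h.1
  have hN := d.eight_le_N a.1
  have hNpos := d.N_pos a.1
  -- support-restricted Duhamel mass bound with `L = 6/5`, `κ = 0`
  have hmain := massL1_duhamelBilin_le_of_support (ι := Fin 3) (c := 4 * π ^ 2)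
    (d.continuous_freePieceC a) (d.continuous_freePieceC b)
    (S := Metric.ball (d.center a + d.center b) (2 * d.ρ)) (L := 6 / 5) (κ := 0)
    (fun r ξ hξ => d.lintegral_freePieceC_mul_eq_zero r r (by
      rwa [Metric.mem_ball, dist_eq_norm, not_lt] at hξ))
    (fun ξ hξ => d.norm_le_of_mem_outputBall_of_low h (by rwa [Metric.mem_ball, dist_eq_norm] at hξ))
    (fun ξ _ => by positivity) ht
  rw [pairTerm]
  refine hmain.trans ?_
  -- the time integral: masses of the two pieces decay at the common rate `2π² N_s²`
  set X : ℝ := d.α * (d.N a.1 + 2) * d.bumpMass with hX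
  have hX0 : 0 ≤ X := by positivity
  have hprod : ∀ r ∈ Ioc (0 : ℝ) t, ENNReal.ofReal (Real.exp (-0 * (t - r))) *
      (massL1 (d.freePieceC a r) * massL1 (d.freePieceC b r)) ≤
      ENNReal.ofReal (X ^ 2) * ENNReal.ofReal (Real.exp (-(4 * π ^ 2 * d.N a.1 ^ 2) * r)) := by
    intro r hr
    have hr0 : max r 0 = r := max_eq_left hr.1.le
    rw [neg_zero, zero_mul, Real.exp_zero, ENNReal.ofReal_one, one_mul]
    have ha' := d.massL1_freePieceC_le a r
    have hb' := d.massL1_freePieceC_le b r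
    rw [hr0] at ha' hb'
    rw [← hs] at hb'
    calc massL1 (d.freePieceC a r) * massL1 (d.freePieceC b r)
        ≤ ENNReal.ofReal (X * Real.exp (-(2 * π ^ 2 * d.N a.1 ^ 2) * r)) *
          ENNReal.ofReal (X * Real.exp (-(2 * π ^ 2 * d.N a.1 ^ 2) * r)) := mul_le_mul' ha' hb'
      _ = _ := by
          rw [← ENNReal.ofReal_mul (by positivity), ← ENNReal.ofReal_mul (by positivity)]
          congr 1
          rw [show -(4 * π ^ 2 * d.N a.1 ^ 2) * r =
            -(2 * π ^ 2 * d.N a.1 ^ 2) * r + -(2 * π ^ 2 * d.N a.1 ^ 2) * r by ring, Real.exp_add]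
          ring
  have hγ : 0 < 4 * π ^ 2 * d.N a.1 ^ 2 := by positivity
  calc nonlinMassConst (Fin 3) * ENNReal.ofReal (6 / 5) *
        ∫⁻ r in Ioc 0 t, ENNReal.ofReal (Real.exp (-0 * (t - r))) *
          (massL1 (d.freePieceC a r) * massL1 (d.freePieceC b r))
      ≤ nonlinMassConst (Fin 3) * ENNReal.ofReal (6 / 5) *
        ∫⁻ r in Ioc 0 t, ENNReal.ofReal (X ^ 2) *
          ENNReal.ofReal (Real.exp (-(4 * π ^ 2 * d.N a.1 ^ 2) * r)) :=
        mul_le_mul' le_rfl (setLIntegral_mono' measurableSet_Ioc hprod)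
    _ ≤ nonlinMassConst (Fin 3) * ENNReal.ofReal (6 / 5) *
        (ENNReal.ofReal (X ^ 2) * ENNReal.ofReal (1 / (4 * π ^ 2 * d.N a.1 ^ 2))) := by
        rw [lintegral_const_mul' _ _ ENNReal.ofReal_ne_top]
        exact mul_le_mul' le_rfl (mul_le_mul' le_rfl (lintegral_Ioc_exp_neg_le hγ t))
    _ = ENNReal.ofReal (36 * π * (6 / 5) * (X ^ 2 * (1 / (4 * π ^ 2 * d.N a.1 ^ 2)))) := by
        rw [nonlinMassConst_fin_three, ← ENNReal.ofReal_mul (by positivity),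
          ← ENNReal.ofReal_mul (by positivity), ← ENNReal.ofReal_mul (by positivity)]
    _ ≤ ENNReal.ofReal (6 * d.α ^ 2 * d.bumpMass ^ 2) := by
        refine ENNReal.ofReal_le_ofReal ?_
        have hπ3 := Real.pi_gt_three
        have hπ : 0 < π := Real.pi_pos
        -- `36π (6/5) X²/(4π² N²) = (54/(5π)) ((N+2)/N)² α² m² ≤ (54/15)(25/16) α² m² < 6 α² m²`
        have hq : (d.N a.1 + 2) ^ 2 ≤ (25 / 16) * d.N a.1 ^ 2 := by nlinarith
        rw [show 36 * π * (6 / 5) * (X ^ 2 * (1 / (4 * π ^ 2 * d.N a.1 ^ 2))) =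
          (54 / 5) / π * ((d.N a.1 + 2) ^ 2 / d.N a.1 ^ 2) * (d.α ^ 2 * d.bumpMass ^ 2) by
          rw [hX]; field_simp; ring]
        have h2 : (d.N a.1 + 2) ^ 2 / d.N a.1 ^ 2 ≤ 25 / 16 := by
          rw [div_le_iff₀ (by positivity)]; linarith
        have h3 : (54 / 5) / π ≤ (54 / 5) / 3 :=
          div_le_div_of_nonneg_left (by norm_num) (by norm_num) hπ3.le
        have hαm : 0 ≤ d.α ^ 2 * d.bumpMass ^ 2 := by positivity
        have h4 : 0 ≤ (54 / 5) / π := by positivity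
        calc (54 / 5) / π * ((d.N a.1 + 2) ^ 2 / d.N a.1 ^ 2) * (d.α ^ 2 * d.bumpMass ^ 2)
            ≤ (54 / 5) / 3 * (25 / 16) * (d.α ^ 2 * d.bumpMass ^ 2) := by
              apply mul_le_mul_of_nonneg_right _ hαm
              exact mul_le_mul h3 h2 (by positivity) (by norm_num)
          _ ≤ 6 * d.α ^ 2 * d.bumpMass ^ 2 := by nlinarith

/-- **Mass of a high pair interaction**: for a high pair and `t ≥ 0`,
`massL1 (pairTerm a b t) ≤ 45 α² m² min(N_a,N_b) e^{-π² max(N_a,N_b)² t}` — the outputs live at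
frequency `≥ (3/4) N_max`, where the heat factor decays at rate `4π²‖ξ‖² ≥ π² N_max²` (we keep
`π² N_max²`), the weight `‖ξ‖ ≤ N_a + N_b + 3` costs one power, and the two masses decay at the
total rate `2π²(N_a² + N_b²) ≥ 2π² N_max²`, leaving the lacunary factor `N_min`
(Bourgain–Pavlović's bounds (3.9)–(3.12) for `N₂`, `N₃`). [cite: BourgainPavlovic2008, (3.9)–(3.12)] -/
theorem massL1_pairTerm_le_of_not_low {a b : ℕ × Bool × Bool} (h : ¬IsLowPair a b) {t : ℝ}
    (ht : 0 ≤ t) :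
    massL1 (d.pairTerm a b t) ≤ ENNReal.ofReal (45 * d.α ^ 2 * d.bumpMass ^ 2 *
      min (d.N a.1) (d.N b.1) * Real.exp (-(π ^ 2 * max (d.N a.1) (d.N b.1) ^ 2) * t)) := by
  have hα := d.α_pos.le
  have hm := d.bumpMass_nonneg
  set Na := d.N a.1 with hNa
  set Nb := d.N b.1 with hNb
  set M := max Na Nb with hM
  have hNa8 : 8 ≤ Na := d.eight_le_N a.1
  have hNb8 : 8 ≤ Nb := d.eight_le_N b.1
  have hMa : Na ≤ M := le_max_left _ _
  have hMb : Nb ≤ M := le_max_right _ _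
  have hM8 : 8 ≤ M := le_trans hNa8 hMa
  have hmin0 : 0 < min Na Nb := lt_min (by linarith) (by linarith)
  have hπ : 0 < π := Real.pi_pos
  have hπ2 : 0 < π ^ 2 := by positivity
  -- support-restricted bound with `L = Na + Nb + 3`, `κ = π² M²` (`4π²‖ξ‖² ≥ 4π²(9/16)M² ≥ π²M²`)
  have hmain := massL1_duhamelBilin_le_of_support (ι := Fin 3) (c := 4 * π ^ 2)
    (d.continuous_freePieceC a) (d.continuous_freePieceC b)
    (S := Metric.ball (d.center a + d.center b) (2 * d.ρ)) (L := Na + Nb + 3) (κ := π ^ 2 * M ^ 2)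
    (fun r ξ hξ => d.lintegral_freePieceC_mul_eq_zero r r (by
      rwa [Metric.mem_ball, dist_eq_norm, not_lt] at hξ))
    (fun ξ hξ => (d.norm_bounds_of_mem_outputBall_of_not_low h
      (by rwa [Metric.mem_ball, dist_eq_norm] at hξ)).2)
    (fun ξ hξ => by
      have hlo := (d.norm_bounds_of_mem_outputBall_of_not_low h
        (by rwa [Metric.mem_ball, dist_eq_norm] at hξ)).1
      rw [← hNa, ← hNb, ← hM] at hlo
      have hM0 : 0 ≤ M := by linarith
      have h34 : 0 ≤ (3 / 4) * M := by positivity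
      have hsq : ((3 / 4) * M) ^ 2 ≤ ‖ξ‖ ^ 2 := pow_le_pow_left₀ h34 hlo 2
      nlinarith [hsq, hπ2]) ht
  rw [pairTerm]
  refine hmain.trans ?_
  -- the time integral
  set A : ℝ := π ^ 2 * M ^ 2 with hA
  set B : ℝ := 2 * π ^ 2 * (Na ^ 2 + Nb ^ 2) with hB
  have hMsq : M ^ 2 ≤ Na ^ 2 + Nb ^ 2 := by
    rcases le_total Na Nb with hab | hab
    · rw [hM, max_eq_right hab]; nlinarith
    · rw [hM, max_eq_left hab]; nlinarith
  have hM2 : 0 < M ^ 2 := by positivity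
  have hA0 : 0 < A := mul_pos hπ2 hM2
  have hBA : π ^ 2 * M ^ 2 ≤ B - A := by
    have h1 : π ^ 2 * M ^ 2 ≤ π ^ 2 * (Na ^ 2 + Nb ^ 2) := mul_le_mul_of_nonneg_left hMsq hπ2.le
    rw [hA, hB]; linarith
  have hAB : A < B := by linarith
  set P : ℝ := d.α * (Na + 2) * d.bumpMass * (d.α * (Nb + 2) * d.bumpMass) with hP
  have hP0 : 0 ≤ P := by positivity
  have hprod : ∀ r ∈ Ioc (0 : ℝ) t, ENNReal.ofReal (Real.exp (-A * (t - r))) *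
      (massL1 (d.freePieceC a r) * massL1 (d.freePieceC b r)) ≤
      ENNReal.ofReal P * (ENNReal.ofReal (Real.exp (-A * (t - r))) *
        ENNReal.ofReal (Real.exp (-B * r))) := by
    intro r hr
    have hr0 : max r 0 = r := max_eq_left hr.1.le
    have ha' := d.massL1_freePieceC_le a r
    have hb' := d.massL1_freePieceC_le b r
    rw [hr0] at ha' hb'
    calc ENNReal.ofReal (Real.exp (-A * (t - r))) * (massL1 (d.freePieceC a r) * massL1 (d.freePieceC b r))
        ≤ ENNReal.ofReal (Real.exp (-A * (t - r))) *
          (ENNReal.ofReal (d.α * (Na + 2) * d.bumpMass * Real.exp (-(2 * π ^ 2 * Na ^ 2) * r)) *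
            ENNReal.ofReal (d.α * (Nb + 2) * d.bumpMass * Real.exp (-(2 * π ^ 2 * Nb ^ 2) * r))) :=
          mul_le_mul' le_rfl (mul_le_mul' ha' hb')
      _ = ENNReal.ofReal P * (ENNReal.ofReal (Real.exp (-A * (t - r))) *
          ENNReal.ofReal (Real.exp (-B * r))) := by
          rw [← ENNReal.ofReal_mul (by positivity), ← ENNReal.ofReal_mul (Real.exp_pos _).le,
            ← ENNReal.ofReal_mul (Real.exp_pos _).le, ← ENNReal.ofReal_mul hP0]
          congr 1
          rw [hP, hB, show -(2 * π ^ 2 * (Na ^ 2 + Nb ^ 2)) * r =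
            -(2 * π ^ 2 * Na ^ 2) * r + -(2 * π ^ 2 * Nb ^ 2) * r by ring, Real.exp_add]
          ring
  calc nonlinMassConst (Fin 3) * ENNReal.ofReal (Na + Nb + 3) *
        ∫⁻ r in Ioc 0 t, ENNReal.ofReal (Real.exp (-A * (t - r))) *
          (massL1 (d.freePieceC a r) * massL1 (d.freePieceC b r))
      ≤ nonlinMassConst (Fin 3) * ENNReal.ofReal (Na + Nb + 3) *
        ∫⁻ r in Ioc 0 t, ENNReal.ofReal P * (ENNReal.ofReal (Real.exp (-A * (t - r))) *
          ENNReal.ofReal (Real.exp (-B * r))) :=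
        mul_le_mul' le_rfl (setLIntegral_mono' measurableSet_Ioc hprod)
    _ ≤ nonlinMassConst (Fin 3) * ENNReal.ofReal (Na + Nb + 3) *
        (ENNReal.ofReal P * ENNReal.ofReal (Real.exp (-A * t) / (B - A))) := by
        rw [lintegral_const_mul' _ _ ENNReal.ofReal_ne_top]
        exact mul_le_mul' le_rfl (mul_le_mul' le_rfl (lintegral_Ioc_exp_exp_le hAB t))
    _ = ENNReal.ofReal (36 * π * (Na + Nb + 3) * (P * (Real.exp (-A * t) / (B - A)))) := by
        rw [nonlinMassConst_fin_three, ← ENNReal.ofReal_mul hP0,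
          ← ENNReal.ofReal_mul (by positivity), ← ENNReal.ofReal_mul (by positivity)]
    _ ≤ _ := by
        refine ENNReal.ofReal_le_ofReal ?_
        have hπ3 := Real.pi_gt_three
        have hBA0 : 0 < B - A := by linarith
        have hexp0 := Real.exp_pos (-A * t)
        -- scalar reductions
        have hL : Na + Nb + 3 ≤ (19 / 8) * M := by
          rcases le_total Na Nb with hab | hab
          · have : M = Nb := by rw [hM, max_eq_right hab]
            rw [this] at hMa ⊢; nlinarith
          · have : M = Na := by rw [hM, max_eq_left hab]
            rw [this] at hMb ⊢; nlinarith
        have hNaNb : Na * Nb = M * min Na Nb := by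
          rcases le_total Na Nb with hab | hab
          · rw [hM, max_eq_right hab, min_eq_left hab]; ring
          · rw [hM, max_eq_left hab, min_eq_right hab]
        have hPle : P ≤ d.α ^ 2 * d.bumpMass ^ 2 * ((25 / 16) * (M * min Na Nb)) := by
          rw [hP, ← hNaNb]
          have : (Na + 2) * (Nb + 2) ≤ (25 / 16) * (Na * Nb) := by nlinarith
          have hαm : 0 ≤ d.α ^ 2 * d.bumpMass ^ 2 := by positivity
          nlinarith
        have hfrac : Real.exp (-A * t) / (B - A) ≤ Real.exp (-A * t) / (π ^ 2 * M ^ 2) :=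
          div_le_div_of_nonneg_left hexp0.le (by positivity) hBA
        set E := Real.exp (-A * t) with hE
        have hkey : 36 * π * (Na + Nb + 3) * (P * (E / (B - A))) ≤
            36 * π * ((19 / 8) * M) * ((d.α ^ 2 * d.bumpMass ^ 2 * ((25 / 16) * (M * min Na Nb))) *
              (E / (π ^ 2 * M ^ 2))) := by
          have h36 : 0 ≤ 36 * π := by positivity
          have hEf : 0 ≤ E / (B - A) := by positivity
          have hEf' : 0 ≤ E / (π ^ 2 * M ^ 2) := by positivity
          have i1 : P * (E / (B - A)) ≤ (d.α ^ 2 * d.bumpMass ^ 2 * ((25 / 16) * (M * min Na Nb))) *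
              (E / (π ^ 2 * M ^ 2)) := mul_le_mul hPle hfrac hEf (by positivity)
          have i0 : 0 ≤ P * (E / (B - A)) := by positivity
          calc 36 * π * (Na + Nb + 3) * (P * (E / (B - A)))
              ≤ 36 * π * ((19 / 8) * M) * (P * (E / (B - A))) := by
                apply mul_le_mul_of_nonneg_right _ i0
                exact mul_le_mul_of_nonneg_left hL h36
            _ ≤ _ := by
                apply mul_le_mul_of_nonneg_left i1
                positivity
        refine hkey.trans ?_
        rw [show 36 * π * ((19 / 8) * M) * ((d.α ^ 2 * d.bumpMass ^ 2 * ((25 / 16) * (M * min Na Nb))) *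
            (E / (π ^ 2 * M ^ 2))) =
            (36 * (19 / 8) * (25 / 16) / π) * (d.α ^ 2 * d.bumpMass ^ 2 * min Na Nb * E) by
          field_simp]
        rw [show 45 * d.α ^ 2 * d.bumpMass ^ 2 * min Na Nb * Real.exp (-(π ^ 2 * max Na Nb ^ 2) * t) =
            45 * (d.α ^ 2 * d.bumpMass ^ 2 * min Na Nb * E) by simp only [hE, hA, hM]; ring]
        have hX : 0 ≤ d.α ^ 2 * d.bumpMass ^ 2 * min Na Nb * E := by positivity
        have hc : 36 * (19 / 8) * (25 / 16) / π ≤ 45 := by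
          rw [div_le_iff₀ hπ]; nlinarith
        exact mul_le_mul_of_nonneg_right hc hX

end InflationParams

end Literature.Analysis.FluidPDE.BourgainPavlovic
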